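import Summits.BirchSwinnertonDyer.BirchSwinnertonDyer.Theorems.SignedLowerHalvesSmallImageLowerHalfBothSignsLambdaLowerThreeNsThetaPartnerOdd
import Summits.BirchSwinnertonDyer.BirchSwinnertonDyer.Theorems.SignedLowerHalvesSmallImageLowerHalfBothSignsLambdaLowerThreeNsThetaPartnerOrientCFT
import Summits.BirchSwinnertonDyer.BirchSwinnertonDyer.Theorems.SignedLowerHalvesSmallImageLowerHalfBothSignsLambdaLowerThreeNsThetaPartnerMatching
import Summits.BirchSwinnertonDyer.BirchSwinnertonDyer.Theorems.SignedLowerHalvesSmallImageLowerHalfBothSignsLambdaLowerThreeNsThetaPartnerTwist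
import Summits.BirchSwinnertonDyer.BirchSwinnertonDyer.Theorems.SignedLowerHalvesSmallImageLowerHalfBothSignsLambdaLowerThreeNsThetaPartnerNebentypus
import Summits.BirchSwinnertonDyer.BirchSwinnertonDyer.Theorems.SignedLowerHalvesSmallImageLowerHalfBothSignsLambdaLowerThreeNsThetaPartnerFrobeniusNorm
import Literature.NumberTheory.GaloisRepresentations.AlgebraicHeckeCharacterGrossencharakterProofs
import Literature.NumberTheory.GaloisRepresentations.ArtinReciprocityCharacterProofs
import HarnessLib

/-!
# The odd-`p` Hecke theta partner from the inert field `K`: assembly of the arithmetic half (brick R6)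

Route `SignedLowerHalves`, child L `SmallImageLowerHalfBothSigns` (item stmt-BirchSwinnertonDyer-23599), line
proposal `rtt_w3`, stub K0₂@p `stub_heckeThetaPartner_ns` — brick R6 (ASSEMBLY) of the arithmetic half at an ODD prime
(width seat `bsd-line-slh-p3-w3` gen 9; memo `Lines/birth_acns-MEMO-w3-g9.md`).  THEOREMS ONLY (no definition, no named
fact, no `sorry`); ROUTE-INDEPENDENT.

`heckeThetaPartner_of_inertField`: let `E = W/ℚ` be globally minimal, `p ≠ 2` good supersingular (`GoodSS W p`), with a
frame `Φ : Aut(E[p]) ≃ GL₂(𝔽_p)` (coordinates `e₀`) whose image normalises the unit group of a field `k ⊆ M₂(𝔽_p)` of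
degree `2` (non-split Cartan case), and let `K` be a quadratic, Galois, totally complex number field with
`res(Γ_K) = U := ρ̄⁻¹(kˣ)` (`hU`, `hKU`), in which `p` is INERT: `v = (p)` is a place of `K` with residue field of
order `p²`, uniformiser `p`, a Frobenius lift `c` on `𝓞 K` mod `v` which is a field endomorphism, `p ∤ d_K`,
`K = ℚ(√Δ)`, `Δ < 0`; let `ι` be an embedding of the residue field of `\bar K_v` into `𝔽̄_p`, `e : ℚ̄_p ≃ ℂ`, and
let `B ≠ 0`, `p ∤ B`, be an integer whose prime factors are exactly the bad primes of `E`, the prime factors of `d_K`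
being bad.  THEN there is a CM newform `g` of weight `2` on some `Γ₀(M)`, `p ∤ M`, every prime factor of `M` bad for `E`,
with `a_p(g) = 0`, a cohomological plus period along `ι_g : K_g → ℚ̄_p`, and `a_ℓ(g) ≡ a_ℓ(E)` (`p`-adically) at every
prime `ℓ ∤ p·M·N_E` — the conclusion of the stub K0₂@p WITHOUT its level clause `max 2 (v_ℓ M) = max 2 (v_ℓ N_E)`.

Assembly (memo §DESIGN): ORIENT-CFT (`…OrientCFT.exists_heckeCharacter_localComponent_eq`: `j`, Teichmüller section
`T`, the Artin character `χ = Teich∘j∘Φρ̄∘res` and its Hecke character `η` with its local component at `v`) → a module of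
definition `(T_η, e_η)` of `η` (`HeckeCharacter.exists_isModulus_of_ramified`) and the integer
`t = d_K · B^{1 + Σ e_η}` → MATCHING (`…Matching`: the embedding `σ' ∈ {σ, σ∘c}` with `σ' ≡ ι` and
`η̃((b)) ≡ σ'(b)` for `b ≡ 1 mod t`, `b ∉ (p)`) → TWIST (`…Twist.exists_grossencharakter_twist`: `λ, ψ₀, ψ`) →
NEBENTYPUS (`…Nebentypus` with `…FrobeniusNorm`) and TRACE (`…TraceCongruence`) → SOCKET
(`…Odd.heckeThetaPartner_of_arithmeticHalf`, Hecke–Ribet–Shimura).  What remains for K0₂@p sans level clause is the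
CONSTRUCTION of `(K, v, c, ι, …)` from the small-image datum `U` (brick AH1) — not done here.  BSD, crux L and the
stub are NOT proved here.

References: Serre 1972 §2, §4; Ribet 1977 §3; Hecke 1926/Shimura 1971–73; Neukirch ANT VI–VII.
-/

set_option autoImplicit false
set_option linter.dupNamespace false

noncomputable section

open scoped Classical NumberField MatrixGroups nonZeroDivisors
open IsDedekindDomain IsDedekindDomain.HeightOneSpectrum Field Matrix NumberField WeierstrassCurve
  Literature.NumberTheory.EllipticCurves Literature.NumberTheory.GaloisRepresentations Rat.HeightOneSpectrum
  Literature.NumberTheory.EllipticCurves.Rank1Residual Summit.BirchSwinnertonDyer.Rank1Residual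
  Literature.NumberTheory.LFunctions Literature.NumberTheory.GaloisRepresentations.HeckeCharacter
  Literature.NumberTheory.GaloisRepresentations.IsNonarchimedeanLocalField
  Literature.NumberTheory.GaloisRepresentations.ModPGaloisRep ValuativeRel
  Literature.NumberTheory.EllipticCurves.ModularForms Literature.NumberTheory.Automorphic
  Summit.BirchSwinnertonDyer.BirchSwinnertonDyer.Theorems.HeckeThetaPartner

namespace Summit.BirchSwinnertonDyer.BirchSwinnertonDyer.Theorems.SmallImageLambdaLowerThreeNsThetaPartner

section Lemmas

variable {K : Type} [Field K] [NumberField K]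

/-- If `p ∣ t` in `𝓞 K` for a rational prime `p` and an integer `t`, then `p ∣ t` in `ℤ` (norms). [folklore] -/
theorem natCast_dvd_of_intCast_mem_span {p : ℕ} (hp : p.Prime) {t : ℤ}
    (h : (t : 𝓞 K) ∈ Ideal.span {(p : 𝓞 K)}) : (p : ℤ) ∣ t := by
  obtain ⟨c, hc⟩ := Ideal.mem_span_singleton'.mp h
  have hdvd : (p : 𝓞 K) ∣ (t : 𝓞 K) := ⟨c, by rw [← hc, mul_comm]⟩
  have hN := map_dvd (Algebra.norm ℤ) hdvd
  rw [show (p : 𝓞 K) = algebraMap ℤ (𝓞 K) (p : ℤ) by simp, show (t : 𝓞 K) = algebraMap ℤ (𝓞 K) t by simp,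
    Algebra.norm_algebraMap, Algebra.norm_algebraMap] at hN
  have hr : Module.finrank ℤ (𝓞 K) ≠ 0 := Module.finrank_pos.ne'
  have _ := hp
  rwa [Int.pow_dvd_pow_iff hr] at hN

/-- The absolute norm of `(t)` for `t ∈ ℤ` in a quadratic field is `t²` (as a natural number, `|t|²`). [folklore] -/
theorem absNorm_span_intCast (hK2 : Module.finrank ℚ K = 2) (t : ℤ) :
    Ideal.absNorm (Ideal.span {(t : 𝓞 K)}) = t.natAbs ^ 2 := by
  rw [Ideal.absNorm_span_singleton, show (t : 𝓞 K) = algebraMap ℤ (𝓞 K) t by simp, Algebra.norm_algebraMap,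
    RingOfIntegers.rank, hK2, Int.natAbs_pow]

/-- In a quadratic field in which `p` is inert (`(p)` prime of residue degree `2`), no ideal has norm `p`. [folklore] -/
theorem absNorm_ne_of_inert {p : ℕ} (hp : p.Prime) {v : HeightOneSpectrum (𝓞 K)}
    (hvp : v.asIdeal = Ideal.span {(p : 𝓞 K)}) (hcard : Nat.card (𝓞 K ⧸ v.asIdeal) = p ^ 2) (I : Ideal (𝓞 K)) :
    Ideal.absNorm I ≠ p := by
  intro hI
  have hprime : I.IsPrime := Ideal.isPrime_of_irreducible_absNorm (hI ▸ hp)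
  have hpI : (p : 𝓞 K) ∈ I := by have := Ideal.absNorm_mem I; rwa [hI] at this
  have hle : v.asIdeal ≤ I := by rw [hvp, Ideal.span_singleton_le_iff_mem]; exact hpI
  have hIv : I = v.asIdeal := (v.isMaximal.eq_of_le hprime.ne_top hle).symm
  have h2 : Ideal.absNorm I = p ^ 2 := by
    rw [hIv, Ideal.absNorm_apply, Submodule.cardQuot_apply, hcard]
  rw [hI] at h2
  have := hp.two_le
  nlinarith [h2, Nat.pow_le_pow_left this 1]

end Lemmas

section Main

variable (W : WeierstrassCurve ℚ) [W.IsElliptic] [W.IsGloballyMinimal] (p : ℕ) [Fact p.Prime]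
  (Φ : Multiplicative (AddAut (geomTorsion W p)) ≃* GL (Fin 2) (ZMod p))
  {k : Subalgebra (ZMod p) (Matrix (Fin 2) (Fin 2) (ZMod p))}
  (K : Type) [Field K] [NumberField K] [IsGalois ℚ K] [IsTotallyComplex K]

set_option maxHeartbeats 800000 in
/-- **The odd-`p` Hecke theta partner from the inert field** (K0₂@p without its level clause, conditional on the
construction of the inert quadratic field `K` of the small-image datum).  See the module docstring.
[cite: Serre1972, §2.2, §4.2] [cite: Ribet1977Nebentypus, §3 Thm. 3.6] [cite: NeukirchANT1999, Ch. VII §6 (6.14)] -/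
theorem heckeThetaPartner_of_inertField (hp2 : p ≠ 2) (hss : GoodSS W p)
    (e₀ : geomTorsion W p ≃+ (Fin 2 → ZMod p))
    (he₀ : ∀ (g : Multiplicative (AddAut (geomTorsion W p))) (x : geomTorsion W p),
      e₀ (Multiplicative.toAdd g x) = ((Φ g : GL (Fin 2) (ZMod p)) : Matrix (Fin 2) (Fin 2) (ZMod p)) *ᵥ e₀ x)
    (hk : IsField k) (h2 : Module.finrank (ZMod p) k = 2)
    (htr : letI : Module (ZMod p) (geomTorsion W p) := AddSubgroup.torsionBy.zmodModule
      ∀ g : Multiplicative (AddAut (geomTorsion W p)),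
        Matrix.trace ((Φ g : GL (Fin 2) (ZMod p)) : Matrix (Fin 2) (Fin 2) (ZMod p)) =
          LinearMap.trace (ZMod p) (geomTorsion W p) ((Multiplicative.toAdd g).toAddMonoidHom.toZModLinearMap p))
    (hGN : (galoisRepTorsion W p).range.map Φ.toMonoidHom ≤
      Subgroup.normalizer (Serre1972.unitGroup k : Set (GL (Fin 2) (ZMod p))))
    (hK2 : Module.finrank ℚ K = 2)
    (hU : ((Serre1972.unitGroup k).comap Φ.toMonoidHom).comap (galoisRepTorsion W p) ≤
      (absGaloisRestrict ℚ K).toMonoidHom.range)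
    (hKU : ∀ τ : absoluteGaloisGroup K,
      Φ (galoisRepTorsion W p (absGaloisRestrict ℚ K τ)) ∈ Serre1972.unitGroup k)
    {v : HeightOneSpectrum (𝓞 K)} (hvp : v.asIdeal = Ideal.span {(p : 𝓞 K)})
    (hgen : ∀ c ∈ IsLocalRing.maximalIdeal (v.adicCompletionIntegers K),
      ((p : ℕ) : v.adicCompletionIntegers K) ∣ c)
    (hπ : (valuation (v.adicCompletion K)).IsUniformizer ((p : ℕ) : v.adicCompletion K))
    (hq : residueFieldCard (v.adicCompletion K) = p ^ 2) (hcard : Nat.card (𝓞 K ⧸ v.asIdeal) = p ^ 2)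
    (ι : absIntegers 𝒪[v.adicCompletion K] (v.adicCompletion K) ⧸ absMaximalIdeal (v.adicCompletion K) →+*
      padicAlgClResidueField p)
    (c : K →+* K) (cO : 𝓞 K →+* 𝓞 K) (hcO : ∀ b : 𝓞 K, ((cO b : 𝓞 K) : K) = c (b : K))
    (hc : ∀ b : 𝓞 K, cO b - b ^ p ∈ v.asIdeal)
    {δ : 𝓞 K} {Δ : ℤ} (hΔ : Δ < 0) (hδ : (δ : K) ^ 2 = (Δ : K))
    (hd4 : NumberField.discr K % 4 = 0 ∨ NumberField.discr K % 4 = 1) (hpd : ¬ (p : ℤ) ∣ NumberField.discr K)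
    (hdK : ∀ (ℓ : ℕ) [Fact ℓ.Prime], (ℓ : ℤ) ∣ NumberField.discr K → ¬ W.HasGoodReductionAtPrime ℓ)
    (B : ℕ) (hB0 : B ≠ 0) (hpB : ¬ p ∣ B) (hBbad : ∀ (ℓ : ℕ) [Fact ℓ.Prime], ℓ ∣ B → ¬ W.HasGoodReductionAtPrime ℓ)
    (hbadB : ∀ (ℓ : ℕ) [Fact ℓ.Prime], ¬ W.HasGoodReductionAtPrime ℓ → ℓ ∣ B)
    (e : PadicAlgCl p ≃+* ℂ) (σ : K →+* ℂ) :
    ∃ (M : ℕ) (_ : NeZero M) (g : CuspForm (CongruenceSubgroup.Gamma0 M) 2)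
      (ιg : coeffField g →+* PadicAlgCl p) (Ω : ℂ),
      ¬ p ∣ M ∧ (∀ (ℓ : ℕ) [Fact ℓ.Prime], ℓ ∣ M → ¬ W.HasGoodReductionAtPrime ℓ) ∧ IsNewform0 g ∧
        IsCMForm (liftToGamma1 M 2 g) ∧ cuspCoeff g p = 0 ∧ IsCohomologicalPlusPeriod g ιg Ω ∧
        ∀ ℓ : ℕ, ℓ.Prime → ¬ ℓ ∣ p * M * W.conductorNorm ℤ →
          ‖embCoeff g ιg ℓ - (W.frobeniusTrace ℓ : PadicAlgCl p)‖ < 1 := by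
  have hp : p.Prime := Fact.out
  have hpv : (p : 𝓞 K) ∈ v.asIdeal := by rw [hvp]; exact Ideal.mem_span_singleton_self _
  have hpPrime : (Ideal.span {(p : 𝓞 K)}).IsPrime := hvp ▸ v.isPrime
  have hUK : ∀ τ : absoluteGaloisGroup ℚ,
      Φ (galoisRepTorsion W p τ) ∈ Serre1972.unitGroup k → τ ∈ (absGaloisRestrict ℚ K).range := by
    intro τ hτ
    obtain ⟨x, hx⟩ := hU (show τ ∈ ((Serre1972.unitGroup k).comap Φ.toMonoidHom).comap (galoisRepTorsion W p)
      from hτ)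
    exact ⟨x, hx⟩
  have hπ₀ : (valuation (v.adicCompletion K)).IsUniformizer
      ((((p : ℕ) : 𝒪[v.adicCompletion K]) : 𝒪[v.adicCompletion K]) : v.adicCompletion K) := by
    simpa using hπ
  /- Step 1: ORIENT-CFT -/
  obtain ⟨j, Tz, χA, η, hTz, hjpow, -, hunrχ, hfin, hram, hFrob, hloc⟩ :=
    exists_heckeCharacter_localComponent_eq W p Φ hp2 hss e₀ he₀ hk h2 hGN K hU hKU hpv hgen hπ₀ hq ι e
  /- Step 2: a module of definition of `η` containing `v`, and the integer `t` -/
  obtain ⟨eM, hmod0⟩ := exists_isModulus_of_ramified η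
  set T : Finset (HeightOneSpectrum (𝓞 K)) := insert v (finite_ramifiedPlaces_holds η).toFinset with hTdef
  have hmod : IsModulus η T eM :=
    hmod0.of_isUnramifiedAt fun w hw hwT => absurd (Finset.mem_insert_of_mem hw) hwT
  have hvT : v ∈ T := Finset.mem_insert_self _ _
  set m : ℕ := 1 + T.sum eM with hmdef
  set t : ℤ := NumberField.discr K * (B : ℤ) ^ m with htdef
  have hd0 : NumberField.discr K ≠ 0 := NumberField.discr_ne_zero K
  have ht0 : t ≠ 0 := mul_ne_zero hd0 (pow_ne_zero _ (by exact_mod_cast hB0))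
  have hdt : NumberField.discr K ∣ t := Dvd.intro _ rfl
  have hd3 : 2 < |NumberField.discr K| := NumberField.abs_discr_gt_two (by rw [hK2]; norm_num)
  have ht3 : 3 ≤ |t| := by
    rw [htdef, abs_mul, abs_pow, Nat.abs_cast]
    have h1 : (1 : ℤ) ≤ (B : ℤ) ^ m := one_le_pow₀ (by exact_mod_cast Nat.one_le_iff_ne_zero.mpr hB0)
    nlinarith
  have hptZ : ¬ (p : ℤ) ∣ t := by
    intro h
    rcases (Int.Prime.dvd_mul' hp h) with h1 | h1
    · exact hpd h1
    · exact hpB (Int.natCast_dvd_natCast.mp (Int.Prime.dvd_pow' hp h1))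
  have hpt : (t : 𝓞 K) ∉ Ideal.span {(p : 𝓞 K)} := fun h => hptZ (natCast_dvd_of_intCast_mem_span hp h)
  -- the prime factors of `t` are bad
  have htbad : ∀ (ℓ : ℕ) [Fact ℓ.Prime], (ℓ : ℤ) ∣ t → ¬ W.HasGoodReductionAtPrime ℓ := by
    intro ℓ _ hℓt
    have hℓ : ℓ.Prime := Fact.out
    rcases Int.Prime.dvd_mul' hℓ hℓt with h1 | h1
    · exact hdK ℓ h1
    · exact hBbad ℓ (Int.natCast_dvd_natCast.mp (Int.Prime.dvd_pow' hℓ h1))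
  have hgood_of : ∀ (ℓ : ℕ) [Fact ℓ.Prime], ¬ (ℓ : ℤ) ∣ t → W.HasGoodReductionAtPrime ℓ := by
    intro ℓ _ hℓt
    by_contra hbad
    exact hℓt ((Int.natCast_dvd_natCast.mpr (hbadB ℓ hbad)).trans
      ((dvd_pow_self (B : ℤ) (by omega)).trans (Dvd.intro_left _ rfl)))
  -- `(t) ≤ w^{e_w + 1}` at the places `w ≠ v` of `T`
  have hTw : ∀ w ∈ T, w ≠ v → (t : 𝓞 K) ∈ w.asIdeal ^ (eM w + 1) := by
    intro w hw hwv
    have hw' : w ∈ (finite_ramifiedPlaces_holds η).toFinset := by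
      rcases Finset.mem_insert.mp hw with h | h
      · exact absurd h hwv
      · exact h
    have hram_w : ¬ η.IsUnramifiedAt w := (Set.Finite.mem_toFinset _).mp hw'
    have hχram : ¬ χA.IsUnramifiedAt w := fun h => hram_w ((hram w).mpr h)
    -- the rational prime under `w`
    set ℓ : ℕ := (primesEquiv (w.under (𝓞 ℚ)) : ℕ) with hℓdef
    haveI : Fact ℓ.Prime := ⟨(primesEquiv (w.under (𝓞 ℚ))).2⟩
    have hℓw : (ℓ : 𝓞 K) ∈ w.asIdeal := (under_eq_iff_natCast_primesEquiv_mem w (w.under (𝓞 ℚ))).mp rfl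
    have hℓp : ℓ ≠ p := by
      intro h
      apply hwv
      have hle : v.asIdeal ≤ w.asIdeal := by
        rw [hvp, Ideal.span_singleton_le_iff_mem, ← h]; exact hℓw
      exact HeightOneSpectrum.ext (v.isMaximal.eq_of_le w.isPrime.ne_top hle).symm
    have hbad : ¬ W.HasGoodReductionAtPrime ℓ := fun hgood => hχram (hunrχ ℓ hℓp hgood w hℓw)
    have hℓB : ℓ ∣ B := hbadB ℓ hbad
    have hBw : (B : 𝓞 K) ∈ w.asIdeal := by
      obtain ⟨r, hr⟩ := hℓB
      rw [hr, Nat.cast_mul]; exact w.asIdeal.mul_mem_right _ hℓw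
    have hm : eM w + 1 ≤ m := by
      have h1 : eM w ≤ T.sum eM := Finset.single_le_sum (f := eM) (fun _ _ => Nat.zero_le _) hw
      rw [hmdef]; omega
    have h1 : ((B : ℤ) ^ m : ℤ) = (((B ^ m : ℕ) : ℤ)) := by push_cast; rfl
    rw [htdef, Int.cast_mul, Int.cast_pow, Int.cast_natCast]
    exact Ideal.mul_mem_left _ _ (Ideal.pow_le_pow_right hm (Ideal.pow_mem_pow hBw m))
  /- Step 3: MATCHING -/
  obtain ⟨R, hR, hRv, -⟩ := exists_ringHom_residue_local (K := K) (p := p) v hvp hπ hcard ι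
  obtain ⟨σ', -, hGR⟩ := exists_embedding_residue_eq (K := K) (p := p) v hvp hcard c cO hcO hc e σ R hRv
  obtain ⟨G, hG, -⟩ := exists_ringHom_residue_embedding (K := K) (p := p) e σ'
  have hσ' : ∀ b : 𝓞 K, IsLocalRing.residue (padicAlgClIntegers p)
      ⟨e.symm (σ' (b : K)), (padicAlgCl_mem_valuationSubring_iff p _).mpr (norm_symm_embedding_le_one e σ' b)⟩ =
      ι (residue (v.adicCompletion K)
        (algebraMap (v.adicCompletion K) (AlgebraicClosure (v.adicCompletion K))
          (algebraMap (𝓞 K) (v.adicCompletion K) b))) := by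
    intro b
    rw [← hG b, hGR G hG b, hR b]
  have hM : ∀ b : 𝓞 K, b ≠ 0 → b ∉ Ideal.span {(p : 𝓞 K)} → b - 1 ∈ Ideal.span {(t : 𝓞 K)} →
      ‖e.symm (idealPow K (fun w => η.valueAtUniformizer w) (Ideal.span {b})) - e.symm (σ' (b : K))‖ < 1 := by
    intro b hb hbp hb1
    refine norm_idealPow_sub_embedding_lt_one (K := K) (p := p) v hvp hπ hcard ι e σ' hσ' Tz hTz hfin hmod hvT
      hloc hb (by rwa [hvp]) fun w hw hwv => ?_
    obtain ⟨r, hr⟩ := Ideal.mem_span_singleton'.mp hb1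
    rw [← hr]
    exact Ideal.mul_mem_left _ _ (hTw w hw hwv)
  /- Step 4: TWIST -/
  obtain ⟨lam, ψ₀, ψ, hC1, hC2, hψG, hC4, hC5⟩ :=
    exists_grossencharakter_twist (K := K) (p := p) hK2 hpPrime hΔ hδ e σ' hfin ht3 hdt hpt hM
  /- Step 5: the socket's hypotheses -/
  have h𝔪 : Ideal.span {(t : 𝓞 K)} ≠ ⊥ := by
    rw [Ne, Ideal.span_singleton_eq_bot]; exact_mod_cast ht0
  have hN𝔪 : Ideal.absNorm (Ideal.span {(t : 𝓞 K)}) = t.natAbs ^ 2 := absNorm_span_intCast hK2 t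
  have hnop : ∀ I : Ideal (𝓞 K), Ideal.absNorm I ≠ p := absNorm_ne_of_inert hp hvp hcard
  have hpD : ¬ p ∣ (NumberField.discr K).natAbs * Ideal.absNorm (Ideal.span {(t : 𝓞 K)}) := by
    rw [hN𝔪]
    intro h
    rcases (Nat.Prime.dvd_mul hp).mp h with h1 | h1
    · exact hpd (Int.natCast_dvd.mpr h1)
    · exact hptZ (Int.natCast_dvd.mpr (Nat.Prime.dvd_of_dvd_pow hp h1))
  have hbad : ∀ (ℓ : ℕ) [Fact ℓ.Prime], ℓ ∣ (NumberField.discr K).natAbs * Ideal.absNorm (Ideal.span {(t : 𝓞 K)}) →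
      ¬ W.HasGoodReductionAtPrime ℓ := by
    intro ℓ _ h
    have hℓ : ℓ.Prime := Fact.out
    rw [hN𝔪] at h
    rcases (Nat.Prime.dvd_mul hℓ).mp h with h1 | h1
    · exact hdK ℓ (Int.natCast_dvd.mpr h1)
    · exact htbad ℓ (Int.natCast_dvd.mpr (Nat.Prime.dvd_of_dvd_pow hℓ h1))
  -- places above a good prime: neither above `p` nor above `t`
  have hwp : ∀ (ℓ : ℕ), ℓ.Prime → ℓ ≠ p → ∀ w : HeightOneSpectrum (𝓞 K), (ℓ : 𝓞 K) ∈ w.asIdeal →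
      ¬ Ideal.span {(p : 𝓞 K)} ≤ w.asIdeal := by
    intro ℓ hℓ hℓp w hℓw hle
    have hpw : (p : 𝓞 K) ∈ w.asIdeal := hle (Ideal.mem_span_singleton_self _)
    have hcop : IsCoprime (ℓ : ℤ) (p : ℤ) := by
      rw [Nat.isCoprime_iff_coprime]; exact (Nat.coprime_primes hℓ hp).mpr hℓp
    obtain ⟨a, b, hab⟩ := hcop
    have h1 : (1 : 𝓞 K) ∈ w.asIdeal := by
      have := congrArg (Int.cast : ℤ → 𝓞 K) hab
      push_cast at this
      rw [← this]
      exact w.asIdeal.add_mem (w.asIdeal.mul_mem_left _ hℓw) (w.asIdeal.mul_mem_left _ hpw)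
    exact w.isPrime.ne_top ((Ideal.eq_top_iff_one _).mpr h1)
  have hwt : ∀ (ℓ : ℕ), ℓ.Prime → ¬ (ℓ : ℤ) ∣ t → ∀ w : HeightOneSpectrum (𝓞 K), (ℓ : 𝓞 K) ∈ w.asIdeal →
      ¬ Ideal.span {(t : 𝓞 K)} ≤ w.asIdeal := by
    intro ℓ hℓ hℓt w hℓw hle
    have htw : (t : 𝓞 K) ∈ w.asIdeal := hle (Ideal.mem_span_singleton_self _)
    have hcop : IsCoprime (ℓ : ℤ) t := (Int.isCoprime_iff_gcd_eq_one.mpr (by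
      rw [Int.gcd_eq_natAbs, Int.natAbs_natCast]
      exact (Nat.Prime.coprime_iff_not_dvd hℓ).mpr fun h => hℓt (Int.natCast_dvd.mpr h)))
    obtain ⟨a, b, hab⟩ := hcop
    have h1 : (1 : 𝓞 K) ∈ w.asIdeal := by
      have := congrArg (Int.cast : ℤ → 𝓞 K) hab
      push_cast at this
      rw [← this]
      exact w.asIdeal.add_mem (w.asIdeal.mul_mem_left _ hℓw) (w.asIdeal.mul_mem_left _ htw)
    exact w.isPrime.ne_top ((Ideal.eq_top_iff_one _).mpr h1)
  -- the Frobenius values of `η` at the places above a good `ℓ ≠ p`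
  have hχv : ∀ (ℓ : ℕ) [Fact ℓ.Prime], ℓ ≠ p → W.HasGoodReductionAtPrime ℓ →
      ∀ w : HeightOneSpectrum (𝓞 K), (ℓ : 𝓞 K) ∈ w.asIdeal →
        ∀ 𝔔 ∈ w.primesAbove, ∀ F : absoluteGaloisGroup K, IsArithFrobAt (𝓞 K) F 𝔔 →
          (fun w => η.valueAtUniformizer w) w =
            e (Tz (j ⟨(Φ (galoisRepTorsion W p (absGaloisRestrict ℚ K F)) : Matrix (Fin 2) (Fin 2) (ZMod p)),
              hKU F⟩)) := by
    intro ℓ _ hℓp hgood w hℓw 𝔔 h𝔔 F hF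
    exact hFrob w (hunrχ ℓ hℓp hgood w hℓw) 𝔔 h𝔔 F hF
  have hneb : ∀ n : ℕ, Odd n → n.Coprime ((NumberField.discr K).natAbs * Ideal.absNorm (Ideal.span {(t : 𝓞 K)})) →
      idealPow K ψ (Ideal.span {(n : 𝓞 K)}) = (jacobiSym (NumberField.discr K) n : ℂ) * (n : ℂ) ^ (2 - 1) := by
    intro n hn hcop
    have hcop' : n.Coprime t.natAbs := by
      rw [hN𝔪] at hcop
      exact Nat.Coprime.coprime_dvd_right ⟨(NumberField.discr K).natAbs * t.natAbs, by ring⟩ hcop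
    refine idealPow_natCast_eq_jacobiSym_mul_of_twist (K := K) (p := p) hp2 e σ' hd4 hdt hptZ hC1 hC2 hψG hC5
      (fun ℓ hℓ hℓp hℓ2 hℓt => ?_) n hn hcop'
    haveI : Fact ℓ.Prime := ⟨hℓ⟩
    have hgood := hgood_of ℓ hℓt
    have hℓd : ¬ (ℓ : ℤ) ∣ NumberField.discr K := fun h => hℓt (h.trans hdt)
    set u : HeightOneSpectrum (𝓞 ℚ) := (primesEquiv (R := 𝓞 ℚ)).symm ⟨ℓ, hℓ⟩ with hu
    have hu' : (primesEquiv u : ℕ) = ℓ := by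
      rw [hu, Equiv.apply_symm_apply]
    exact norm_symm_idealPow_span_prime_sub_lt_one W p Φ K hk h2 e₀ he₀ hGN hK2 hKU hUK j e Tz hTz hjpow
      (fun w => η.valueAtUniformizer w) hℓp hℓ2 hgood hu' hℓd (hχv ℓ hℓp hgood)
  have htrace : ∀ (ℓ : ℕ) [Fact ℓ.Prime], ℓ ≠ p → W.HasGoodReductionAtPrime ℓ →
      ‖e.symm (∑ᶠ (w : HeightOneSpectrum (𝓞 K)) (_ : Ideal.absNorm w.asIdeal = ℓ), ψ w) -
        (W.frobeniusTrace ℓ : PadicAlgCl p)‖ < 1 := by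
    intro ℓ _ hℓp hgood
    have hℓ : ℓ.Prime := Fact.out
    have hℓd : ¬ (ℓ : ℤ) ∣ NumberField.discr K := fun h => hdK ℓ h hgood
    have hℓt : ¬ (ℓ : ℤ) ∣ t := fun h => htbad ℓ h hgood
    set u : HeightOneSpectrum (𝓞 ℚ) := (primesEquiv (R := 𝓞 ℚ)).symm ⟨ℓ, hℓ⟩ with hu
    have hu' : (primesEquiv u : ℕ) = ℓ := by
      rw [hu, Equiv.apply_symm_apply]
    refine norm_finsum_sub_frobeniusTrace_lt_one W p Φ K hk h2 htr hGN hK2 hKU hUK j e Tz hTz hjpow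
      (fun w => η.valueAtUniformizer w) ψ hℓp hgood hu' (isUnramifiedIn_asIdeal_of_not_dvd_discr hu' hℓd)
      (hχv ℓ hℓp hgood) fun w hℓw => hC4 w (hwp ℓ hℓ hℓp w hℓw) (hwt ℓ hℓ hℓt w hℓw)
  /- Step 6: the socket -/
  obtain ⟨M, hM0, g, ιg, Ω, hMdvd, hpM, hnew, hcm, hap, hΩ, hcong⟩ :=
    heckeThetaPartner_of_arithmeticHalf W p K hK2 inferInstance σ' (Ideal.span {(t : 𝓞 K)}) h𝔪 ψ e hnop hpD hbad
      hψG hneb htrace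
  exact ⟨M, hM0, g, ιg, Ω, hpM, fun ℓ _ hℓM => hbad ℓ (hℓM.trans hMdvd), hnew, hcm, hap, hΩ, hcong⟩

end Main

end Summit.BirchSwinnertonDyer.BirchSwinnertonDyer.Theorems.SmallImageLambdaLowerThreeNsThetaPartner

end
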